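import Mathlib
import Summits.Ventures.PercRepro2.Defs
import Summits.Ventures.PercRepro2.Harris
import Summits.Ventures.PercRepro2.Graph
import Summits.Ventures.PercRepro2.Exploration
import Summits.Ventures.PercRepro2.Events
import Summits.Ventures.PercRepro2.CutVertexDefs
import Summits.Ventures.PercRepro2.CDCutVertex

/-!
# The three-event form (T_h) across a cut vertex (blind cell PercRepro2, mine-a g46;
MINE-A.md §101.5)

Let `x` be a cut vertex (`CutV.IsCut ends x VA VB EA EB`) with the root `s ∈ VA`, the hit vertex
`h ∈ VB`, and up-sets `𝓤`, `𝓥` of vertex sets READ ON `VB` ONLY (`S ∈ 𝓤 ↔ S ∩ VB ∈ 𝓤`, `∅ ∉ 𝓤`).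
With `Q = {h ∈ C_s}`, `U = {C_s ∈ 𝓤}`, `e = {C_s ∈ 𝓥}` and the (T)-form

  `T(p, s) := P(Q ∩ U ∩ e) + P(Q) P(U ∩ e) − P(Q ∩ U) P(e) − P(Q ∩ e) P(U)`

of `TFKG` (MINE-A.md §95.6), the cluster of `s` enters `B` only through `x` (`CutV.cluster_eq_union`,
`CutV.cluster_eq_of_not_conn`), so each of the seven events is `{s ↔ x inside A} ∩ {a B-side event}`
(`hit_eq`, `clusterInEvent_eq`) and the product law `CutV.prob_sideEvent_inter_eq_mul` factorises
every probability as `ξ · P_{p'}(B-side event)`, where `ξ = P(s ↔ x)` and `p'` closes the `A`-edges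
(`CDCutVertex.prob_zeroOff_eq_prob_sideEvent`).  Hence the EXACT identity

  **`T(p, s) = ξ² · T(p', x) + ξ (1 − ξ) · P_{p'}(Q' ∩ U' ∩ e')`**   (`t_cut_identity`)

with `Q', U', e'` the same events for the root `x` under `p'`, and (T_h) on `G` follows from (T_h) on
the `B`-side with root `x` (`t_of_cut`): every class of the lane's kernel ((T_h) on forests and
triangular cacti, `TFKG`; on the star-reduced classes, `TStar`) transfers across a cut vertex
toward the root.  Checked exactly (Fractions) on 25 random glued multigraphs, 0 mismatches
(data/mine-a/g46/codes).  No definition; one seat.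
-/

namespace Summit.Ventures.PercRepro2

namespace TCutVertex

open CutV

variable {V : Type*} {E : Type*}

/-! ## The seven events across the cut -/
section Events

variable {ends : E → Sym2 V} {x : V} {VA VB : Set V} {EA EB : Set E}
  [DecidablePred (· ∈ EA)] [DecidablePred (· ∈ EB)]

/-- A side event of an intersection is the intersection of the side events. -/
lemma sideEvent_inter (F : Set E) [DecidablePred (· ∈ F)] (X Y : Set (Config E)) :
    sideEvent F (X ∩ Y) = sideEvent F X ∩ sideEvent F Y := by
  ext ω
  simp only [mem_sideEvent, Set.mem_inter_iff]

omit [DecidablePred (· ∈ EB)] in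
/-- The `A`-side cluster of an `A`-vertex misses `VB`. -/
lemma cluster_restrict_inter_eq_empty (h : IsCut ends x VA VB EA EB) {ω : Config E} {s : V}
    (hs : s ∈ VA) : cluster ends (restrict EA ω) s ∩ VB = ∅ := by
  apply Set.eq_empty_of_forall_notMem
  intro v hv
  have hv1 : v ∈ VA ∪ {x} := cluster_restrict_subset h (Or.inl hs) hv.1
  rcases hv1 with hvA | hvx
  · exact h.disj.notMem_of_mem_left hvA hv.2
  · rw [Set.mem_singleton_iff] at hvx
    rw [hvx] at hv
    exact h.x_notB hv.2

/-- On `{s ↔ x inside A}`, the `VB`-part of the cluster of `s` is the `VB`-part of the `B`-cluster of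
`x`. -/
lemma cluster_inter_VB_of_conn (h : IsCut ends x VA VB EA EB) {ω : Config E} {s : V} (hs : s ∈ VA)
    (hx : Conn ends (restrict EA ω) s x) :
    cluster ends ω s ∩ VB = cluster ends (restrict EB ω) x ∩ VB := by
  rw [cluster_eq_union h hs hx, Set.union_inter_distrib_right, cluster_restrict_inter_eq_empty h hs,
    Set.empty_union]

/-- Off `{s ↔ x inside A}`, the cluster of `s` misses `VB`. -/
lemma cluster_inter_VB_of_not_conn (h : IsCut ends x VA VB EA EB) {ω : Config E} {s : V}
    (hs : s ∈ VA) (hx : ¬ Conn ends (restrict EA ω) s x) :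
    cluster ends ω s ∩ VB = ∅ := by
  rw [cluster_eq_of_not_conn h hs hx]
  exact cluster_restrict_inter_eq_empty h hs

/-- **The hit event across the cut**: `{h ∈ C_s} = {s ↔ x inside A} ∩ {h ∈ C_x inside B}`. -/
theorem hit_eq (h : IsCut ends x VA VB EA EB) {s hv : V} (hs : s ∈ VA) (hvB : hv ∈ VB) :
    clusterInEvent ends s {T : Set V | hv ∈ T} =
      sideEvent EA (connEvent ends s x) ∩ sideEvent EB (clusterInEvent ends x {T : Set V | hv ∈ T}) := by
  ext ω
  simp only [mem_clusterInEvent, Set.mem_setOf_eq, Set.mem_inter_iff, mem_sideEvent]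
  rw [mem_cluster_of_mem_B_iff h hs hvB, mem_cluster_x_iff h hs]
  exact Iff.rfl

/-- **A `VB`-supported cluster event across the cut**: `{C_s ∈ 𝓤} = {s ↔ x inside A} ∩ {C_x ∈ 𝓤 inside B}`
for an up-set `𝓤` read on `VB` (`S ∈ 𝓤 ↔ S ∩ VB ∈ 𝓤`) with `∅ ∉ 𝓤`. -/
theorem clusterInEvent_eq (h : IsCut ends x VA VB EA EB) {s : V} (hs : s ∈ VA) {𝓤 : Set (Set V)}
    (h𝓤 : ∀ S, S ∈ 𝓤 ↔ S ∩ VB ∈ 𝓤) (h𝓤0 : ∅ ∉ 𝓤) :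
    clusterInEvent ends s 𝓤 =
      sideEvent EA (connEvent ends s x) ∩ sideEvent EB (clusterInEvent ends x 𝓤) := by
  ext ω
  simp only [mem_clusterInEvent, Set.mem_inter_iff, mem_sideEvent]
  change cluster ends ω s ∈ 𝓤 ↔ Conn ends (restrict EA ω) s x ∧ cluster ends (restrict EB ω) x ∈ 𝓤
  by_cases hx : Conn ends (restrict EA ω) s x
  · have key : cluster ends ω s ∈ 𝓤 ↔ cluster ends (restrict EB ω) x ∈ 𝓤 := by
      rw [h𝓤 (cluster ends ω s), h𝓤 (cluster ends (restrict EB ω) x),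
        cluster_inter_VB_of_conn h hs hx]
    exact ⟨fun hU => ⟨hx, key.1 hU⟩, fun hU => key.2 hU.2⟩
  · have hno : cluster ends ω s ∉ 𝓤 := by
      rw [h𝓤 (cluster ends ω s), cluster_inter_VB_of_not_conn h hs hx]
      exact h𝓤0
    exact ⟨fun hU => absurd hU hno, fun hU => absurd hU.1 hx⟩

end Events

/-! ## The identity and the reduction -/
section Main

variable [Fintype E] [DecidableEq E] {R : Type*} [Field R] [LinearOrder R] [IsStrictOrderedRing R]
variable {ends : E → Sym2 V} {x : V} {VA VB : Set V} {EA EB : Set E}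
  [DecidablePred (· ∈ EA)] [DecidablePred (· ∈ EB)]

omit [LinearOrder R] [IsStrictOrderedRing R] in
/-- The probability of `{s ↔ x inside A} ∩ {B-side event}` is `ξ · P_{p'}(B-side event)`, where `p'`
closes the `A`-edges. -/
lemma prob_near_inter_side (p : E → R) (h : IsCut ends x VA VB EA EB) {s : V} (hs : s ∈ VA)
    (X : Set (Config E)) :
    prob p (sideEvent EA (connEvent ends s x) ∩ sideEvent EB X) =
      prob p (connEvent ends s x) * prob (fun e => if e ∈ EB then p e else 0) X := by
  rw [prob_sideEvent_inter_eq_mul p h, CDCutVertex.prob_zeroOff_eq_prob_sideEvent p EB X,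
    ← connEvent_eq_sideEvent h (Or.inl hs) (Or.inr rfl)]

omit [LinearOrder R] [IsStrictOrderedRing R] in
/-- **The (T)-form across a cut vertex**: with `ξ = P(s ↔ x)` and `p'` the weight vector closing the
`A`-edges, `T(p, s) = ξ² T(p', x) + ξ (1 − ξ) P_{p'}(Q' ∩ U' ∩ e')`. -/
theorem t_cut_identity (p : E → R) (h : IsCut ends x VA VB EA EB) {s hv : V} (hs : s ∈ VA)
    (hvB : hv ∈ VB) {𝓤 𝓥 : Set (Set V)} (h𝓤 : ∀ S, S ∈ 𝓤 ↔ S ∩ VB ∈ 𝓤) (h𝓤0 : ∅ ∉ 𝓤)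
    (h𝓥 : ∀ S, S ∈ 𝓥 ↔ S ∩ VB ∈ 𝓥) (h𝓥0 : ∅ ∉ 𝓥) :
    prob p (clusterInEvent ends s {T : Set V | hv ∈ T} ∩ clusterInEvent ends s 𝓤 ∩
        clusterInEvent ends s 𝓥) +
      prob p (clusterInEvent ends s {T : Set V | hv ∈ T}) *
        prob p (clusterInEvent ends s 𝓤 ∩ clusterInEvent ends s 𝓥) -
      prob p (clusterInEvent ends s {T : Set V | hv ∈ T} ∩ clusterInEvent ends s 𝓤) *
        prob p (clusterInEvent ends s 𝓥) -
      prob p (clusterInEvent ends s {T : Set V | hv ∈ T} ∩ clusterInEvent ends s 𝓥) *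
        prob p (clusterInEvent ends s 𝓤) =
    prob p (connEvent ends s x) ^ 2 *
        (prob (fun e => if e ∈ EB then p e else 0)
            (clusterInEvent ends x {T : Set V | hv ∈ T} ∩ clusterInEvent ends x 𝓤 ∩
              clusterInEvent ends x 𝓥) +
          prob (fun e => if e ∈ EB then p e else 0) (clusterInEvent ends x {T : Set V | hv ∈ T}) *
            prob (fun e => if e ∈ EB then p e else 0)
              (clusterInEvent ends x 𝓤 ∩ clusterInEvent ends x 𝓥) -
          prob (fun e => if e ∈ EB then p e else 0)
              (clusterInEvent ends x {T : Set V | hv ∈ T} ∩ clusterInEvent ends x 𝓤) *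
            prob (fun e => if e ∈ EB then p e else 0) (clusterInEvent ends x 𝓥) -
          prob (fun e => if e ∈ EB then p e else 0)
              (clusterInEvent ends x {T : Set V | hv ∈ T} ∩ clusterInEvent ends x 𝓥) *
            prob (fun e => if e ∈ EB then p e else 0) (clusterInEvent ends x 𝓤)) +
      prob p (connEvent ends s x) * (1 - prob p (connEvent ends s x)) *
        prob (fun e => if e ∈ EB then p e else 0)
          (clusterInEvent ends x {T : Set V | hv ∈ T} ∩ clusterInEvent ends x 𝓤 ∩
            clusterInEvent ends x 𝓥) := by
  set A := sideEvent EA (connEvent ends s x) with hA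
  have hQ := hit_eq (EA := EA) h hs hvB
  have hU := clusterInEvent_eq (EA := EA) h hs h𝓤 h𝓤0
  have hE := clusterInEvent_eq (EA := EA) h hs h𝓥 h𝓥0
  rw [hQ, hU, hE]
  -- regroup the seven events as `A ∩ sideEvent EB (B-side event)`
  have r1 : A ∩ sideEvent EB (clusterInEvent ends x {T : Set V | hv ∈ T}) ∩
      (A ∩ sideEvent EB (clusterInEvent ends x 𝓤)) ∩ (A ∩ sideEvent EB (clusterInEvent ends x 𝓥)) =
      A ∩ sideEvent EB (clusterInEvent ends x {T : Set V | hv ∈ T} ∩ clusterInEvent ends x 𝓤 ∩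
        clusterInEvent ends x 𝓥) := by
    rw [sideEvent_inter, sideEvent_inter]; ext ω; simp only [Set.mem_inter_iff]; tauto
  have r2 : A ∩ sideEvent EB (clusterInEvent ends x 𝓤) ∩ (A ∩ sideEvent EB (clusterInEvent ends x 𝓥)) =
      A ∩ sideEvent EB (clusterInEvent ends x 𝓤 ∩ clusterInEvent ends x 𝓥) := by
    rw [sideEvent_inter]; ext ω; simp only [Set.mem_inter_iff]; tauto
  have r3 : A ∩ sideEvent EB (clusterInEvent ends x {T : Set V | hv ∈ T}) ∩
      (A ∩ sideEvent EB (clusterInEvent ends x 𝓤)) =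
      A ∩ sideEvent EB (clusterInEvent ends x {T : Set V | hv ∈ T} ∩ clusterInEvent ends x 𝓤) := by
    rw [sideEvent_inter]; ext ω; simp only [Set.mem_inter_iff]; tauto
  have r4 : A ∩ sideEvent EB (clusterInEvent ends x {T : Set V | hv ∈ T}) ∩
      (A ∩ sideEvent EB (clusterInEvent ends x 𝓥)) =
      A ∩ sideEvent EB (clusterInEvent ends x {T : Set V | hv ∈ T} ∩ clusterInEvent ends x 𝓥) := by
    rw [sideEvent_inter]; ext ω; simp only [Set.mem_inter_iff]; tauto
  rw [r1, r2, r3, r4, hA]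
  simp only [prob_near_inter_side p h hs]
  ring

/-- **(T_h) transfers across a cut vertex toward the root**: if the (T)-inequality holds on the `B`-side
with the root `x` (weights `p'` closing the `A`-edges), it holds on `G` with the root `s ∈ VA`. -/
theorem t_of_cut (p : E → R) (hp : IsProbVec p) (h : IsCut ends x VA VB EA EB) {s hv : V}
    (hs : s ∈ VA) (hvB : hv ∈ VB) {𝓤 𝓥 : Set (Set V)} (h𝓤 : ∀ S, S ∈ 𝓤 ↔ S ∩ VB ∈ 𝓤)
    (h𝓤0 : ∅ ∉ 𝓤) (h𝓥 : ∀ S, S ∈ 𝓥 ↔ S ∩ VB ∈ 𝓥) (h𝓥0 : ∅ ∉ 𝓥)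
    (hB : prob (fun e => if e ∈ EB then p e else 0)
            (clusterInEvent ends x {T : Set V | hv ∈ T} ∩ clusterInEvent ends x 𝓤) *
          prob (fun e => if e ∈ EB then p e else 0) (clusterInEvent ends x 𝓥) +
        prob (fun e => if e ∈ EB then p e else 0) (clusterInEvent ends x 𝓤) *
          prob (fun e => if e ∈ EB then p e else 0)
            (clusterInEvent ends x {T : Set V | hv ∈ T} ∩ clusterInEvent ends x 𝓥) ≤
        prob (fun e => if e ∈ EB then p e else 0)
            (clusterInEvent ends x {T : Set V | hv ∈ T} ∩ clusterInEvent ends x 𝓤 ∩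
              clusterInEvent ends x 𝓥) +
          prob (fun e => if e ∈ EB then p e else 0) (clusterInEvent ends x {T : Set V | hv ∈ T}) *
            prob (fun e => if e ∈ EB then p e else 0)
              (clusterInEvent ends x 𝓤 ∩ clusterInEvent ends x 𝓥)) :
    prob p (clusterInEvent ends s {T : Set V | hv ∈ T} ∩ clusterInEvent ends s 𝓤) *
        prob p (clusterInEvent ends s 𝓥) +
      prob p (clusterInEvent ends s 𝓤) *
        prob p (clusterInEvent ends s {T : Set V | hv ∈ T} ∩ clusterInEvent ends s 𝓥) ≤
      prob p (clusterInEvent ends s {T : Set V | hv ∈ T} ∩ clusterInEvent ends s 𝓤 ∩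
          clusterInEvent ends s 𝓥) +
        prob p (clusterInEvent ends s {T : Set V | hv ∈ T}) *
          prob p (clusterInEvent ends s 𝓤 ∩ clusterInEvent ends s 𝓥) := by
  have hid := t_cut_identity p h hs hvB h𝓤 h𝓤0 h𝓥 h𝓥0
  have hp' : IsProbVec (fun e => if e ∈ EB then p e else 0) := CDCutVertex.isProbVec_zeroOff hp EB
  have hξ0 : 0 ≤ prob p (connEvent ends s x) := prob_nonneg hp _
  have hξ1 : prob p (connEvent ends s x) ≤ 1 := prob_le_one hp _
  have hβ : 0 ≤ prob (fun e => if e ∈ EB then p e else 0)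
      (clusterInEvent ends x {T : Set V | hv ∈ T} ∩ clusterInEvent ends x 𝓤 ∩
        clusterInEvent ends x 𝓥) := prob_nonneg hp' _
  have hTB : 0 ≤ prob (fun e => if e ∈ EB then p e else 0)
            (clusterInEvent ends x {T : Set V | hv ∈ T} ∩ clusterInEvent ends x 𝓤 ∩
              clusterInEvent ends x 𝓥) +
          prob (fun e => if e ∈ EB then p e else 0) (clusterInEvent ends x {T : Set V | hv ∈ T}) *
            prob (fun e => if e ∈ EB then p e else 0)
              (clusterInEvent ends x 𝓤 ∩ clusterInEvent ends x 𝓥) -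
          prob (fun e => if e ∈ EB then p e else 0)
              (clusterInEvent ends x {T : Set V | hv ∈ T} ∩ clusterInEvent ends x 𝓤) *
            prob (fun e => if e ∈ EB then p e else 0) (clusterInEvent ends x 𝓥) -
          prob (fun e => if e ∈ EB then p e else 0)
              (clusterInEvent ends x {T : Set V | hv ∈ T} ∩ clusterInEvent ends x 𝓥) *
            prob (fun e => if e ∈ EB then p e else 0) (clusterInEvent ends x 𝓤) := by
    linarith
  have h1 : 0 ≤ prob p (connEvent ends s x) ^ 2 * _ := mul_nonneg (sq_nonneg _) hTB
  have h2 : 0 ≤ prob p (connEvent ends s x) * (1 - prob p (connEvent ends s x)) * _ :=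
    mul_nonneg (mul_nonneg hξ0 (by linarith)) hβ
  linarith [hid, h1, h2]

end Main

end TCutVertex

end Summit.Ventures.PercRepro2
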